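import Literature.NumberTheory.Automorphic.ArchLocalSplitSingularCentralizer   -- ★ (V9): `exists_centralizer_continuousMulEquiv_of_splitSingular` (`Z_{G_w}(diag(z₀,z₁,z₀)) ≃ₜ* G₂ × G₁`)
import Mathlib.Analysis.SpecialFunctions.Trigonometric.DerivHyp
import HarnessLib

/-!
# The indefinite rank-one unitary group `U(e₀, e₁)(ℂ)` (`e₀e₁ < 0`) is NOT compact; hence the centraliser of a torus point at a NONCOMPACT wall of `U(σ_w diag α)(ℂ)` is not compact
(Rogawski (1990) §8.2 p. 122 «whose centralizer is `H` … `U(1,1) × U(1)`»; Knapp (2002) I §1; Platonov–Rapinchuk (1994) §3.2)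

Topic `NumberTheory/Automorphic`; namespace `Literature.NumberTheory.Automorphic.UnitaryGroup`.  THEOREMS ONLY (no definition, no instance, no notation, no named fact, no `sorry`).
Cell `pub/hodgecm-mathlib`, crux H413 (`stmt-HodgeConjecture-24833`); (ST-∞) witness road (W1-coh) of census `CENSUS-E4b-SingularPinsBuilt` 1291225b (F0P3-p03 (g10)): the case split
«compact wall ∕ noncompact wall» of the pinned centraliser family is by COMPACTNESS OF THE CENTRALISER, which must therefore be shown to FAIL at a noncompact wall (the compact case is ★
`isCompact_centralizer_circleDiagonal_compactWall`).  Author F0P3-p03 (g10), 2026-09-01.  HONEST LABEL: HC_CM is proved only modulo the printed citations until rung 0 closes; elementary.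

* §1 `hyperbolic_transpose_mul_diagonal_mul` (+ private `lt_cosh_two_mul_abs_add_two`) (the real `2 × 2` identity `h_tᵀ · diag(x₀,x₁) · h_t = diag(x₀,x₁)` for `h_t = [[cosh t, r₁ sinh t], [r₂ sinh t, cosh t]]` under
  `x₀r₁ + x₁r₂ = 0`, `x₁r₂² = −x₀`, `x₀r₁² = −x₁`) and **`not_compactSpace_unitaryGroupOfForm_rankOne_indefinite`**: for `a : Fin 2 → L`, `σ : L →+* ℂ` with `σ(a_i)` real and
  `re σa₀ · re σa₁ < 0`, `U(σ, diag a)(ℂ)` contains the `h_t` (`r₁ = r`, `r₂ = r⁻¹`, `r = √(−re σa₁ ∕ re σa₀)`), whose `(0,0)`-entries `cosh t` are unbounded — so it is not compact.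
* §2 **`not_isCompact_centralizer_circleDiagonal_noncompactWall`**: at a complex place `w`, for `z₀ = z₂ ≠ z₁` and `re σ_wα₀ · re σ_wα₂ < 0`, the centraliser `Z_{G_w}(diag z)` in
  `G_w = U(σ_w diag α)(ℂ)` is not compact (★ (V9) `Z ≃ₜ* U(σ_w diag(α₀,α₂)) × U(σ_w α₁)` and §1), and **`not_compactSpace_centralizer_circleDiagonal_noncompactWall`**.

## References
* [Rogawski1990] J. D. Rogawski, *Automorphic Representations of Unitary Groups in Three Variables*, Ann. of Math. Stud. 123 (1990), §8.2 p. 122.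
* [Knapp2002] A. W. Knapp, *Lie Groups Beyond an Introduction*, 2nd ed. (2002), I §1 (the groups `U(p,q)`; `SU(1,1)`).
* [PlatonovRapinchuk1994] V. Platonov, A. Rapinchuk, *Algebraic Groups and Number Theory* (1994), §3.2.
-/

set_option autoImplicit false

noncomputable section

open MeasureTheory Set NumberField NumberField.InfinitePlace Matrix Topology
open scoped Matrix MatrixGroups

namespace Literature.NumberTheory.Automorphic.UnitaryGroup

/-! ## §1 `U(e₀, e₁)(ℂ)` with `e₀e₁ < 0` is not compact -/

section RankOne

/-- The real hyperbolic matrix `h_t = [[cosh t, r₁ sinh t], [r₂ sinh t, cosh t]]` preserves the diagonal form `diag(x₀, x₁)`, `h_tᵀ · diag(x₀,x₁) · h_t = diag(x₀,x₁)`, as soon as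
`x₀r₁ + x₁r₂ = 0`, `x₁r₂² = −x₀`, `x₀r₁² = −x₁` (e.g. `r₁ = r`, `r₂ = r⁻¹`, `x₀r² = −x₁`).  Four polynomial identities in `cosh² t − sinh² t = 1`. [cite: Knapp2002, I §1] -/
theorem hyperbolic_transpose_mul_diagonal_mul (x₀ x₁ r₁ r₂ t : ℝ) (hrel : x₀ * r₁ + x₁ * r₂ = 0) (h1 : x₁ * r₂ ^ 2 = -x₀) (h2 : x₀ * r₁ ^ 2 = -x₁) :
    (!![Real.cosh t, r₁ * Real.sinh t; r₂ * Real.sinh t, Real.cosh t] : Matrix (Fin 2) (Fin 2) ℝ)ᵀ *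
        Matrix.diagonal ![x₀, x₁] * !![Real.cosh t, r₁ * Real.sinh t; r₂ * Real.sinh t, Real.cosh t] =
      Matrix.diagonal ![x₀, x₁] := by
  have hcs : Real.cosh t ^ 2 - Real.sinh t ^ 2 = 1 := Real.cosh_sq_sub_sinh_sq t
  ext i j
  fin_cases i <;> fin_cases j <;>
    simp [Matrix.mul_apply, Fin.sum_univ_two, Matrix.diagonal, Matrix.of_apply]
  · linear_combination x₀ * hcs + Real.sinh t ^ 2 * h1
  · linear_combination (Real.cosh t * Real.sinh t) * hrel
  · linear_combination (Real.cosh t * Real.sinh t) * hrel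
  · linear_combination x₁ * hcs + Real.sinh t ^ 2 * h2

/-- `cosh` is unbounded: `M < cosh (2|M| + 2)` (from `cosh x ≥ eˣ∕2 ≥ (x + 1)∕2`). [folklore] -/
private theorem lt_cosh_two_mul_abs_add_two (M : ℝ) : M < Real.cosh (2 * |M| + 2) := by
  have h1 : 2 * |M| + 2 + 1 ≤ Real.exp (2 * |M| + 2) := Real.add_one_le_exp _
  have h2 : 0 < Real.exp (-(2 * |M| + 2)) := Real.exp_pos _
  rw [Real.cosh_eq]
  have hM : M ≤ |M| := le_abs_self M
  linarith

variable {L : Type*} [CommRing L] (σ : L →+* ℂ) (a : Fin 2 → L)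

/-- **`U(e₀, e₁)(ℂ)` IS NOT COMPACT WHEN `e₀e₁ < 0`.**  With `x_i = re σ(a_i)` real of opposite signs, the real hyperbolic matrices `h_t` (`r = √(−x₁∕x₀)`) lie in `U(σ, diag a)(ℂ)`
(they are real, so `σ`-conjugation is the identity on them, and `h_tᵀ diag(x) h_t = diag(x)`), and their `(0,0)`-entry `cosh t` is unbounded, whereas the continuous function
`g ↦ re g₀₀` is bounded on a compact group.  [cite: Knapp2002, I §1] [cite: Rogawski1990, §8.2 p. 122] -/
theorem not_compactSpace_unitaryGroupOfForm_rankOne_indefinite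
    (hreal : ∀ i, (σ (a i)).im = 0) (hsgn : (σ (a 0)).re * (σ (a 1)).re < 0) :
    ¬ CompactSpace (unitaryGroupOfForm (starRingEnd ℂ) ((Matrix.diagonal a).map σ)) := by
  intro hK
  -- the real parameters `x₀, x₁` and `r = √(−x₁∕x₀)`
  set x₀ : ℝ := (σ (a 0)).re with hx₀
  set x₁ : ℝ := (σ (a 1)).re with hx₁
  have hx₀0 : x₀ ≠ 0 := fun h => by rw [h, zero_mul] at hsgn; exact lt_irrefl _ hsgn
  have hq : 0 < -x₁ / x₀ := by
    rcases lt_or_gt_of_ne hx₀0 with h | h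
    · have : 0 < x₁ := by nlinarith
      exact div_pos_of_neg_of_neg (by linarith) h
    · have : x₁ < 0 := by nlinarith
      exact div_pos (by linarith) h
  set r : ℝ := Real.sqrt (-x₁ / x₀) with hr_def
  have hr : 0 < r := Real.sqrt_pos.2 hq
  have hr0 : r ≠ 0 := hr.ne'
  have hr2 : r ^ 2 = -x₁ / x₀ := Real.sq_sqrt hq.le
  have h2 : x₀ * r ^ 2 = -x₁ := by rw [hr2]; field_simp
  have h1 : x₁ * r⁻¹ ^ 2 = -x₀ := by
    have h : x₁ = -(x₀ * r ^ 2) := by rw [h2, neg_neg]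
    rw [h]; field_simp
  have hrel : x₀ * r + x₁ * r⁻¹ = 0 := by
    have h : x₁ = -(x₀ * r ^ 2) := by rw [h2, neg_neg]
    rw [h]; field_simp; ring
  -- `σ(a_i)` are the real numbers `x_i`
  have ha : ∀ i, σ (a i) = ((σ (a i)).re : ℂ) := fun i => Complex.ext rfl (by simp [hreal i])
  have hD : (Matrix.diagonal a).map σ = (Matrix.diagonal ![x₀, x₁]).map (algebraMap ℝ ℂ) := by
    rw [Matrix.diagonal_map (map_zero σ), Matrix.diagonal_map (map_zero (algebraMap ℝ ℂ))]
    congr 1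
    funext i
    fin_cases i
    · simpa [hx₀] using ha 0
    · simpa [hx₁] using ha 1
  -- the hyperbolic elements
  have hmem : ∀ t : ℝ, ∃ g : unitaryGroupOfForm (starRingEnd ℂ) ((Matrix.diagonal a).map σ),
      ((g : GL (Fin 2) ℂ) : Matrix (Fin 2) (Fin 2) ℂ) 0 0 = (Real.cosh t : ℂ) := by
    intro t
    set hR : Matrix (Fin 2) (Fin 2) ℝ := !![Real.cosh t, r * Real.sinh t; r⁻¹ * Real.sinh t, Real.cosh t] with hR_def
    have hdetR : hR.det = 1 := by
      rw [hR_def, Matrix.det_fin_two_of]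
      have hcs : Real.cosh t ^ 2 - Real.sinh t ^ 2 = 1 := Real.cosh_sq_sub_sinh_sq t
      field_simp
      linear_combination hcs
    have hdet : (hR.map (algebraMap ℝ ℂ)).det ≠ 0 := by
      rw [← RingHom.mapMatrix_apply, ← RingHom.map_det, hdetR, map_one]; exact one_ne_zero
    refine ⟨⟨Matrix.GeneralLinearGroup.mkOfDetNeZero _ hdet, ?_⟩, ?_⟩
    · rw [mem_unitaryGroupOfForm_iff, Matrix.GeneralLinearGroup.val_mkOfDetNeZero, hD]
      have hconj : (hR.map (algebraMap ℝ ℂ)).map (starRingEnd ℂ) = hR.map (algebraMap ℝ ℂ) := by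
        rw [Matrix.map_map]
        congr 1
        funext x
        exact Complex.conj_ofReal x
      rw [hconj, ← Matrix.transpose_map, ← Matrix.map_mul, ← Matrix.map_mul,
        hyperbolic_transpose_mul_diagonal_mul x₀ x₁ r r⁻¹ t hrel h1 h2]
    · simp [hR_def]
  -- the continuous function `g ↦ re g₀₀` is bounded on the compact group, contradiction
  have hf : Continuous fun g : unitaryGroupOfForm (starRingEnd ℂ) ((Matrix.diagonal a).map σ) =>
      ((((g : GL (Fin 2) ℂ) : Matrix (Fin 2) (Fin 2) ℂ) 0 0).re) :=
    Complex.continuous_re.comp ((Units.continuous_val.comp continuous_subtype_val).matrix_elem 0 0)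
  obtain ⟨M, hM⟩ := (isCompact_univ.image hf).isBounded.bddAbove
  obtain ⟨g, hg⟩ := hmem (2 * |M| + 2)
  have hle : (((g : GL (Fin 2) ℂ) : Matrix (Fin 2) (Fin 2) ℂ) 0 0).re ≤ M := hM ⟨g, Set.mem_univ _, rfl⟩
  rw [hg, Complex.ofReal_re] at hle
  exact (lt_cosh_two_mul_abs_add_two M).not_ge hle

end RankOne

/-! ## §2 The centraliser at a noncompact wall of `U(σ_w diag α)(ℂ)` is not compact -/

section Place

variable (L : Type) [Field L] (α : Fin 3 → L) (w : {w : InfinitePlace L // IsComplex w})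

/-- **AT A NONCOMPACT WALL THE CENTRALISER IS NOT COMPACT**: for `z₀ = z₂ ≠ z₁` and `re σ_wα₀ · re σ_wα₂ < 0`, the centraliser of the torus point `diag z` in `G_w = U(σ_w diag α)(ℂ)` —
`≃ₜ* U(σ_w diag(α₀,α₂))(ℂ) × U(σ_w α₁)(ℂ)` by ★ (V9) — is not compact, since its first factor is the indefinite `U(e₀,e₂)` of §1.  [cite: Rogawski1990, §8.2 p. 122] [cite: Knapp2002, I §1] -/
theorem not_compactSpace_centralizer_circleDiagonal_noncompactWall (hreal : ∀ i, (w.1.embedding (α i)).im = 0)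
    (hnc : (w.1.embedding (α 0)).re * (w.1.embedding (α 2)).re < 0) {z : Fin 3 → Circle} (h02 : z 0 = z 2) (h01 : z 0 ≠ z 1) :
    ¬ CompactSpace (Subgroup.centralizer ({(⟨circleDiagonal 3 z, circleDiagonal_mem_archLocal_diagonal L 3 α w z⟩ : archLocal L 3 (Matrix.diagonal α) w)} :
      Set (archLocal L 3 (Matrix.diagonal α) w))) := by
  intro hK
  obtain ⟨e, -⟩ := exists_centralizer_continuousMulEquiv_of_splitSingular L α w h02 h01
  -- the product `G₂ × G₁` is compact, hence so is `G₂`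
  haveI : CompactSpace (unitaryGroupOfForm (starRingEnd ℂ) ((Matrix.diagonal ![α 0, α 2]).map w.1.embedding) ×
      unitaryGroupOfForm (starRingEnd ℂ) ((Matrix.diagonal ![α 1]).map w.1.embedding)) := @Homeomorph.compactSpace _ _ _ _ hK e.toHomeomorph
  have h2 : CompactSpace (unitaryGroupOfForm (starRingEnd ℂ) ((Matrix.diagonal ![α 0, α 2]).map w.1.embedding)) := by
    refine ⟨?_⟩
    have h := (isCompact_univ (X := unitaryGroupOfForm (starRingEnd ℂ) ((Matrix.diagonal ![α 0, α 2]).map w.1.embedding) ×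
      unitaryGroupOfForm (starRingEnd ℂ) ((Matrix.diagonal ![α 1]).map w.1.embedding))).image continuous_fst
    rwa [Set.image_univ, Prod.range_fst] at h
  have hreal2 : ∀ i, (w.1.embedding (![α 0, α 2] i)).im = 0 := fun i => by
    fin_cases i
    · exact hreal 0
    · exact hreal 2
  have hsgn2 : (w.1.embedding (![α 0, α 2] 0)).re * (w.1.embedding (![α 0, α 2] 1)).re < 0 := by simpa using hnc
  exact not_compactSpace_unitaryGroupOfForm_rankOne_indefinite w.1.embedding ![α 0, α 2] hreal2 hsgn2 h2

/-- Set form: the centraliser at a noncompact wall is not a compact SUBSET of `G_w` (the currency of ★ `isCompact_centralizer_circleDiagonal_compactWall`).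
[cite: Rogawski1990, §8.2 p. 122] -/
theorem not_isCompact_centralizer_circleDiagonal_noncompactWall (hreal : ∀ i, (w.1.embedding (α i)).im = 0)
    (hnc : (w.1.embedding (α 0)).re * (w.1.embedding (α 2)).re < 0) {z : Fin 3 → Circle} (h02 : z 0 = z 2) (h01 : z 0 ≠ z 1) :
    ¬ IsCompact ((Subgroup.centralizer ({(⟨circleDiagonal 3 z, circleDiagonal_mem_archLocal_diagonal L 3 α w z⟩ : archLocal L 3 (Matrix.diagonal α) w)} :
      Set (archLocal L 3 (Matrix.diagonal α) w)) : Subgroup (archLocal L 3 (Matrix.diagonal α) w)) : Set (archLocal L 3 (Matrix.diagonal α) w)) := fun h =>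
  not_compactSpace_centralizer_circleDiagonal_noncompactWall L α w hreal hnc h02 h01 (isCompact_iff_compactSpace.1 h)

end Place

end Literature.NumberTheory.Automorphic.UnitaryGroup

end
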